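import Literature.AlgebraicGeometry.Resolution.PointBlowupShade
import Literature.AlgebraicGeometry.Resolution.PointBlowupShadeCentres

/-!
# [OURS · L1 W4.6] Rung (iii) "Moh window" for the classical pair (order, shade) — STATEMENTS

Cell `res-hironaka`, rung L (rescue), slot W4.6 (restricted regimes as rungs of the typed Th. 16.6
procedure), rung (iii) «purely inseparable `z^p = f` with `ord f < 2p` (Moh window)», seat
`res-L1-s46-pv-6` (second prover of (iii): the rung read on the CLASSICAL secondary invariant, Hauser's
shade, via the kangaroo-atlas model).  STATEMENT-ONLY file (OURS predicates, no theorem) for the OURS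
desk; the closers `…_holds` are in `MarkedTransferCampaignW46MohWindowShadeHolds.lean`, the proofs in
`MarkedTransferCampaignW46MohWindowShade.lean` (p471643) / `…ShadeCentres.lean`, the `decide`
certificate over the enumerated families in `…ShadeCert.lean`.

Vocabulary (tree, `Literature/AlgebraicGeometry/Resolution/PointBlowupShade.lean` and
`PointBlowupShadeCentres.lean`, the typed model of [Hauser2010, §§F–G]): a STATE `s = (F, r)` of
`x^p + F(y)` — `F ∈ K[y_σ]` the residual polynomial, kept CLEANED of `p`-th power monomials
(`deletePthPowers p F = F`), `y^r` the exceptional monomial (`y^r ∣ F` monomialwise) —, its shade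
`ord₀ F − |r|`, the point blow-up `PointBlowup.step p j b s` (chart `y_j`, point `b` of the exceptional
divisor, `b_j = 0`), `IsEquimultiplePoint` (the transform is again `p`-fold), `ShadeIncreases` /
`ShadeStalls`; and the coordinate-centre blow-up `CentreBlowup.step p S j b s` of
`C_S = {x = 0, y_i = 0 (i ∈ S)}` with `degIn S`, `CState`.  THE WINDOW of regime (iii) is read on the
TOTAL order of the current residual polynomial, `p ≤ ord₀ F < 2p` (= `|r| + shade`), at EVERY step
(SIZED-ASK-L §S: "state the window as a hypothesis on every step"); on the residual order `shade` alone
the statements below are false (Hauser's antelope `y³z³(y² + z²)`, `p = 2`: shade `2 < 2p`, and the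
shade jumps — tree `KangarooAtlasCert.hauser_shades`).

Each predicate carries the parameters `(p, K, σ)` (prime, field of characteristic `p`, finite set of
residual variables = every dimension); nothing of the manuscript [claim: Hironaka2017, status:
under-review] is used or asserted; the roles named are those the predicates REPLACE in regime (iii),
they are NOT statements of the manuscript.  AI review is weaker than expert review.
-/

noncomputable section

set_option linter.dupNamespace false -- mandated namespace of this single-conjunct summit

namespace Summit.ResolutionOfSingularities.ResolutionOfSingularities.Theorems

open Literature.AlgebraicGeometry.Resolution
open Literature.AlgebraicGeometry.Resolution.Hauser2010

/-- [OURS · L1 W4.6] replaces the role of Th. 16.6 (2) / Eq. (127), ms. p. 84 l. 10–20 («the strict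
inequality holds … at every point `ξ′ ∈ π⁻¹(D) ∖ D′`»), in regime (iii) of RESCUE-SEED W4.6, for the
CLASSICAL pair (order, shade) and POINT centres: inside the Moh window `p ≤ ord₀ F < 2p` the shade of
`x^p + F(y)` does not increase at any equimultiple point of any chart of the blow-up of the origin —
NO KANGAROO POINT INSIDE THE WINDOW.  Hypotheses: state cleaned, `y^r ∣ F`, `b_j = 0`,
`IsEquimultiplePoint`; every field `K` of characteristic `p`, every finite `σ`.  NOT a statement of the
manuscript. -/
def CampaignW46MohWindowShadeNoKangaroo (p : ℕ) (K : Type*) [Field K] [DecidableEq K] [CharP K p]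
    (σ : Type*) [Fintype σ] [DecidableEq σ] : Prop :=
  ∀ (j : σ) (b : σ → K), b j = 0 → ∀ s : PointBlowup.State σ K,
    deletePthPowers p s.F = s.F → (p : ℕ∞) ≤ ordZero s.F → ordZero s.F < (2 * p : ℕ) →
    (∀ d ∈ s.F.support, s.r ≤ d) → PointBlowup.IsEquimultiplePoint p j b s →
    ¬ PointBlowup.ShadeIncreases p j b s

/-- [OURS · L1 W4.6] companion of `CampaignW46MohWindowShadeNoKangaroo` with no printed counterpart
(it says WHICH steps of the window can move the shade): at the bottom edge of the window, `ord₀ F = p`,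
the shade is FROZEN — every equimultiple point of every chart is a stall (`ShadeStalls`: neither a
drop nor an increase), because no exceptional component of positive multiplicity is lost there; so
inside the window the shade moves only at steps with `p < ord₀ F < 2p`, and then only down.  The
classical counterpart of the cusp-string stall measured by kill test K4.6 (cell file
`L/res-L0-k46/KILL-TEST-K4.6.md` §4).  NOT a statement of the manuscript. -/
def CampaignW46MohWindowShadeFrozen (p : ℕ) (K : Type*) [Field K] [DecidableEq K] [CharP K p]
    (σ : Type*) [Fintype σ] [DecidableEq σ] : Prop :=
  ∀ (j : σ) (b : σ → K), b j = 0 → ∀ s : PointBlowup.State σ K,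
    deletePthPowers p s.F = s.F → ordZero s.F = p → (∀ d ∈ s.F.support, s.r ≤ d) →
    PointBlowup.IsEquimultiplePoint p j b s → PointBlowup.ShadeStalls p j b s

/-- [OURS · L1 W4.6] replaces the role of Th. 16.6 (2) / Eq. (127), ms. p. 84 l. 4–20, for PERMISSIBLE
CENTRES OF POSITIVE DIMENSION («any smooth closed irreducible subscheme `D` of `∇(E)` such that the
blowup … with center `D` is permissible», l. 4–6) in regime (iii), for the classical pair: inside
`ord₀ F < 2p`, the blow-up of a coordinate centre `C_S` (`j ∈ S`) lying in the `p`-fold locus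
(`degIn S d ≥ p` on the support) and Moh-permissible (`degIn S d ≥ degIn S r + shade`) does not increase
the shade at any equimultiple point of the fibre over the origin (`b_j = 0`, `b_i = 0` off `S`).
Tree model `CentreBlowup` (`PointBlowupShadeCentres.lean`).  NOT a statement of the manuscript. -/
def CampaignW46MohWindowShadeCentreNoKangaroo (p : ℕ) (K : Type*) [Field K] [DecidableEq K]
    [CharP K p] (σ : Type*) [Fintype σ] [DecidableEq σ] : Prop :=
  ∀ (S : Finset σ) (j : σ), j ∈ S → ∀ b : σ → K, b j = 0 → (∀ i, i ∉ S → b i = 0) →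
    ∀ s : CentreBlowup.CState σ K, deletePthPowers p s.F = s.F → ordZero s.F < (2 * p : ℕ) →
    (∀ d ∈ s.F.support, s.r ≤ d) → (∀ d ∈ s.F.support, p ≤ CentreBlowup.degIn S d) →
    (∀ d ∈ s.F.support,
      ((CentreBlowup.degIn S s.r : ℕ) : ℕ∞) + s.shade ≤ (CentreBlowup.degIn S d : ℕ)) →
    CentreBlowup.IsEquimultiplePoint p S j b s → (CentreBlowup.step p S j b s).shade ≤ s.shade

/-- [OURS · L1 W4.6] replaces the role of the monotonicity half of the termination argument of
Th. 16.13, ms. p. 87 l. 26–29 (the repeated procedure §16.3), in regime (iii), for the classical pair: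
along ANY sequence of equimultiple point blow-ups `s_{n+1} = step p (j n) (b n) (s n)` from a cleaned
state with `y^r ∣ F` and `ord₀ F ≥ p` that stays in the window (`ord₀ F_n < 2p` for `n < N`), the shade
is non-increasing up to `N`.  (Termination itself is carried by the primary invariants and is NOT
claimed: at `ord₀ F = p` the shade is frozen, `CampaignW46MohWindowShadeFrozen`.)  NOT a statement of
the manuscript. -/
def CampaignW46MohWindowShadeAntitone (p : ℕ) (K : Type*) [Field K] [DecidableEq K] [CharP K p]
    (σ : Type*) [Fintype σ] [DecidableEq σ] : Prop :=
  ∀ (s : ℕ → PointBlowup.State σ K) (j : ℕ → σ) (b : ℕ → σ → K), (∀ n, b n (j n) = 0) →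
    (∀ n, s (n + 1) = PointBlowup.step p (j n) (b n) (s n)) →
    deletePthPowers p (s 0).F = (s 0).F → (∀ d ∈ (s 0).F.support, (s 0).r ≤ d) →
    (p : ℕ∞) ≤ ordZero (s 0).F → (∀ n, PointBlowup.IsEquimultiplePoint p (j n) (b n) (s n)) →
    ∀ N : ℕ, (∀ n, n < N → ordZero (s n).F < (2 * p : ℕ)) →
    ∀ n m : ℕ, n ≤ m → m ≤ N → (s m).shade ≤ (s n).shade

end Summit.ResolutionOfSingularities.ResolutionOfSingularities.Theorems
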